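import Summits.BirchSwinnertonDyer.BirchSwinnertonDyer.Theorems.ErratumRoadFiveNonSurjCornerKolyJProp44LocalValue
import Summits.BirchSwinnertonDyer.Rank1Residual.X11b.KolyvaginH44ConcreteData
import HarnessLib

/-!
# McCallum 1991, Prop. 4.4 under (irr) — KERNEL ROUTE, step (b1): the decomposition group at the Kolyvagin prime
# `λ = (ℓ)` acts on `K[mℓ]` through `G_ℓ = Gal(K[mℓ]/K[m]) = ⟨σ_ℓ⟩` (for COMPATIBLE data), so McCallum's cocycle of
# `P_{mℓ}` on `Γ_{K_λ}` only sees `ḡ = σ_ℓ^{j(g)}`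
# (cell `bsd-stepL`, seat `bsd-stepL-corner-p1` g9; `--supports stmt-BirchSwinnertonDyer-19947`; memo CORNER-G9 §3 (b))

WHAT. Sibling of `…Prop44LocalValue` (step (a)) and `…Prop44Manin` (step (c)). For Kolyvagin–Heegner data `d` (conductor
`m`) and `d'` (conductor `n'`, in the application `n' = mℓ`) whose embeddings are COMPATIBLE along `K[m] ⊆ K[n'] ⊆ ℂ`
(the binder `hemb` of the typed `McCallum1991.prop44_localOrder_kolyvaginClass_mul_eq`: `d'.emb x' = d.emb x` whenever
`(x : ℂ) = x'`), and a restriction `π'` of `Γ_K` to `Aut(K[n'])` through `d'.emb` (`τ • d'.emb x' = d'.emb (π' τ x')`,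
tree `KolyvaginH44.exists_absGaloisRestrict`):
* `restrict_mem_ringClassGalOver_of_mem_decompositionSubgroup` — every `g` in the decomposition group of a prime
  `𝔓 ∣ λ = (ℓ)` (`ℓ ∤ m` inert) restricts into `Gal(K[n']/K[m])` (`ringClassGalOver ι n' m`): `g` fixes `d.emb(K[m])`
  (step (a) `Prop44.smul_ringClassField_eq_self_of_mem_decompositionSubgroup`), hence `d'.emb` of the elements of `K[n']`
  lying in `K[m]`, and `d'.emb` is injective;
* `restrict_mem_zpowers_of_mem_decompositionSubgroup` — for `n' = m ℓ`: `π' g ∈ ⟨σ_ℓ⟩` (`d'.zpowers_σ`: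
  `⟨σ_ℓ⟩ = Gal(K[mℓ]/K[m])`), i.e. `ḡ = σ_ℓ^{j}` for some `j` — «the image of `Γ_{K_λ}` in `Gal(K_{mℓ}/K)` is the
  decomposition group `G_ℓ` of `λ″`» (Gross §3: `λ_m` totally ramified in `K_{mℓ}`, split from `K`);
* `absGaloisRestrict_restrict_mem_zpowers` — the same for `Γ_{K_λ}` through `res` (`G_{𝔓₀} = res Γ_{K_λ}`).
So on `Γ_{K_λ}` the correction term `(g − 1)P_{mℓ}` of McCallum's cocycle is `(σ_ℓ^j − 1)P_{mℓ}` — step (b2) (the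
explicit `K[mℓ]`-rational root `Q_σ` of `(σ_ℓ − 1)P_{mℓ}`, Gross Prop. 3.6) is next. HONEST FRAMING: theorems only; no
definition ∕ fact ∕ sorry; nothing about BSD; no stub closes; T7.
References: [GrossLMS1991] §3 (p. 239–240: `G_ℓ`, «λ_m totally ramified in K_n», proof of Prop. 3.7 (2)); [McCallumLMS1991]
§4 (p. 301), proof of Prop. 4.4 (p. 302); [NeukirchANT1999] I §9 (9.4).
-/

set_option autoImplicit false
set_option linter.dupNamespace false

noncomputable section

open scoped Classical NumberField

namespace Summit.BirchSwinnertonDyer.BirchSwinnertonDyer.Theorems.Prop44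

open WeierstrassCurve NumberField IsDedekindDomain Field
  Literature.NumberTheory.EllipticCurves Literature.NumberTheory.GaloisRepresentations
  Literature.NumberTheory.EllipticCurves.ModularForms Literature.NumberTheory.Automorphic

-- `K : Type`: the tree's ring-class class field theory is universe `0`.
variable {K : Type} [Field K] [NumberField K] {N : ℕ} [NeZero N] {W : WeierstrassCurve ℚ}
  {Dt : ModularParametrizationData W N} {β : ℤ} {ι : K →+* ℂ} {m n' : ℕ}
  (d : KolyvaginHeegnerData Dt β ι m) (d' : KolyvaginHeegnerData Dt β ι n')

/-- **The decomposition group at `λ = (ℓ)` restricts into `Gal(K[n']/K[m])`** for COMPATIBLE data (`ℓ ∤ m` inert,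
`m ≠ 0`, any `𝔓 ∣ λ`): if `τ • d'.emb x' = d'.emb (π' τ x')` for all `τ, x'` and `d'.emb` restricts to `d.emb` on
`K[m] ⊆ K[n']`, then `π' g` fixes every element of `K[n']` lying in `K[m]`, for `g ∈ G_𝔓`: `d'.emb (π' g x') =
g • d'.emb x' = g • d.emb x = d.emb x = d'.emb x'` (step (a) §1) and `d'.emb` is injective.
[cite: GrossLMS1991, §3 (proof of Prop. 3.7 (2)), §4] [cite: McCallumLMS1991, §4 (p. 301)] -/
theorem restrict_mem_ringClassGalOver_of_mem_decompositionSubgroup (hK : IsImaginaryQuadratic K) (hm : m ≠ 0)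
    {ℓ : ℕ} (hℓp : ℓ.Prime) (hℓP : (Ideal.span {(ℓ : 𝓞 K)}).IsPrime) (hℓm : Nat.Coprime ℓ m)
    (w : HeightOneSpectrum (𝓞 K)) (hw : (ℓ : 𝓞 K) ∈ w.asIdeal) {𝔓 : Ideal (absIntegers (𝓞 K) K)}
    (h𝔓 : 𝔓 ∈ w.primesAbove)
    (hemb : ∀ (x : ringClassField K ι m) (x' : ringClassField K ι n'), (x : ℂ) = x' → d'.emb x' = d.emb x)
    (π' : absoluteGaloisGroup K → (ringClassField K ι n' ≃ₐ[ℚ] ringClassField K ι n'))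
    (hπ' : ∀ (τ : absoluteGaloisGroup K) (x' : ringClassField K ι n'), τ • d'.emb x' = d'.emb (π' τ x'))
    {g : absoluteGaloisGroup K} (hg : g ∈ 𝔓.decompositionSubgroup (absoluteGaloisGroup K)) :
    π' g ∈ ringClassGalOver ι n' m := by
  rw [ringClassGalOver, mem_fixingSubgroup_iff]
  rintro x' (hx' : (x' : ℂ) ∈ ringClassField K ι m)
  -- the element of `K[m]` under `x'`
  set x : ringClassField K ι m := ⟨(x' : ℂ), hx'⟩ with hx
  have hxx' : (x : ℂ) = x' := rfl
  let e : ringClassField K ι m →ₐ[K] AlgebraicClosure K := { d.emb with commutes' := fun k ↦ d.emb_apply k }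
  have he : ∀ y, e y = d.emb y := fun _ ↦ rfl
  have hfix : g • d.emb x = d.emb x := by
    have h := smul_ringClassField_eq_self_of_mem_decompositionSubgroup K hK ι hm hℓp hℓP hℓm w hw h𝔓 e hg x
    rwa [he] at h
  have h1 : d'.emb (π' g x') = d'.emb x' := by
    rw [← hπ' g x', hemb x x' hxx', hfix]
  exact d'.emb.injective h1

/-- **For `n' = mℓ`: `π' g ∈ ⟨σ_ℓ⟩`** — the decomposition group at `λ` acts on `K[mℓ]` through the cyclic group
`G_ℓ = Gal(K[mℓ]/K[m])` generated by the datum's `σ_ℓ` (`d'.zpowers_σ`): `ḡ = σ_ℓ^{j(g)}`. (`ℓ` prime, `ℓ ∤ m`, so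
`mℓ / ℓ = m` and `ℓ ∈ (mℓ).primeFactors`.) [cite: GrossLMS1991, §3 (p. 239: G_ℓ = ⟨σ_ℓ⟩; λ_m totally ramified in K_{mℓ})]
[cite: McCallumLMS1991, §4 proof of Prop. 4.4 (p. 302)] -/
theorem restrict_mem_zpowers_of_mem_decompositionSubgroup (hK : IsImaginaryQuadratic K) (hm : m ≠ 0)
    {ℓ : ℕ} (hℓp : ℓ.Prime) (hℓP : (Ideal.span {(ℓ : 𝓞 K)}).IsPrime) (hℓm : ¬ ℓ ∣ m)
    (dℓ : KolyvaginHeegnerData Dt β ι (m * ℓ))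
    (w : HeightOneSpectrum (𝓞 K)) (hw : (ℓ : 𝓞 K) ∈ w.asIdeal) {𝔓 : Ideal (absIntegers (𝓞 K) K)}
    (h𝔓 : 𝔓 ∈ w.primesAbove)
    (hemb : ∀ (x : ringClassField K ι m) (x' : ringClassField K ι (m * ℓ)), (x : ℂ) = x' → dℓ.emb x' = d.emb x)
    (π' : absoluteGaloisGroup K → (ringClassField K ι (m * ℓ) ≃ₐ[ℚ] ringClassField K ι (m * ℓ)))
    (hπ' : ∀ (τ : absoluteGaloisGroup K) (x' : ringClassField K ι (m * ℓ)), τ • dℓ.emb x' = dℓ.emb (π' τ x'))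
    {g : absoluteGaloisGroup K} (hg : g ∈ 𝔓.decompositionSubgroup (absoluteGaloisGroup K)) :
    π' g ∈ Subgroup.zpowers (dℓ.σ ℓ) := by
  have hcop : Nat.Coprime ℓ m := (Nat.Prime.coprime_iff_not_dvd hℓp).mpr hℓm
  have hℓmem : ℓ ∈ (m * ℓ).primeFactors :=
    Nat.mem_primeFactors.mpr ⟨hℓp, dvd_mul_left ℓ m, mul_ne_zero hm hℓp.ne_zero⟩
  have hdiv : m * ℓ / ℓ = m := Nat.mul_div_cancel m hℓp.pos
  rw [dℓ.zpowers_σ ℓ hℓmem, hdiv]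
  exact restrict_mem_ringClassGalOver_of_mem_decompositionSubgroup d dℓ hK hm hℓp hℓP hcop w hw h𝔓 hemb π' hπ' hg

/-- **`Γ_{K_λ}` acts on `K[mℓ]` through `⟨σ_ℓ⟩`**: for every `g ∈ Γ_{K_λ}`, `π' (res g) = σ_ℓ^j` for some `j`
(`G_{𝔓₀} = res Γ_{K_λ}`, `decompositionSubgroup_adicCompletionPrime_eq_range`). So McCallum's cocycle of `P_{mℓ}` evaluated
on `Γ_{K_λ}` has correction term `(σ_ℓ^j − 1)P_{mℓ}` only (CORNER-G9 §3 (b)). [cite: McCallumLMS1991, §4 proof of Prop. 4.4 (p. 302)]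
[cite: NeukirchANT1999, Ch. II §9 Prop. (9.6)] -/
theorem exists_restrict_absGaloisRestrict_eq_pow (hK : IsImaginaryQuadratic K) (hm : m ≠ 0)
    {ℓ : ℕ} (hℓp : ℓ.Prime) (hℓP : (Ideal.span {(ℓ : 𝓞 K)}).IsPrime) (hℓm : ¬ ℓ ∣ m) (hsq : Squarefree (m * ℓ))
    (dℓ : KolyvaginHeegnerData Dt β ι (m * ℓ))
    (w : HeightOneSpectrum (𝓞 K)) (hw : (ℓ : 𝓞 K) ∈ w.asIdeal)
    (hemb : ∀ (x : ringClassField K ι m) (x' : ringClassField K ι (m * ℓ)), (x : ℂ) = x' → dℓ.emb x' = d.emb x)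
    (π' : absoluteGaloisGroup K → (ringClassField K ι (m * ℓ) ≃ₐ[ℚ] ringClassField K ι (m * ℓ)))
    (hπ' : ∀ (τ : absoluteGaloisGroup K) (x' : ringClassField K ι (m * ℓ)), τ • dℓ.emb x' = dℓ.emb (π' τ x'))
    (g : absoluteGaloisGroup (w.adicCompletion K)) :
    ∃ j : ℕ, π' (absGaloisRestrict K (w.adicCompletion K) g) = dℓ.σ ℓ ^ j := by
  have hmem : absGaloisRestrict K (w.adicCompletion K) g ∈
      (adicCompletionPrime K w).decompositionSubgroup (absoluteGaloisGroup K) := by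
    rw [decompositionSubgroup_adicCompletionPrime_eq_range]
    exact ⟨g, rfl⟩
  have hz := restrict_mem_zpowers_of_mem_decompositionSubgroup d hK hm hℓp hℓP hℓm dℓ w hw
    (adicCompletionPrime_mem_primesAbove K w) hemb π' hπ' hmem
  -- `σ_ℓ ^ (ℓ + 1) = 1`, so `⟨σ_ℓ⟩` consists of natural powers
  have hℓmem : ℓ ∈ (m * ℓ).primeFactors :=
    Nat.mem_primeFactors.mpr ⟨hℓp, dvd_mul_left ℓ m, mul_ne_zero hm hℓp.ne_zero⟩
  have hord : IsOfFinOrder (dℓ.σ ℓ) :=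
    isOfFinOrder_iff_pow_eq_one.mpr ⟨ℓ + 1, Nat.succ_pos ℓ, dℓ.σ_pow_succ_eq_one hK hsq hℓmem hℓP⟩
  obtain ⟨j, hj⟩ := (hord.mem_powers_iff_mem_zpowers).mpr hz
  exact ⟨j, hj.symm⟩

/-- **On `E(K̄)`: every `g ∈ Γ_{K_λ}` acts on `E(K[mℓ]) ⊆ E(K̄)` as some power `σ_ℓ^j`** — for all
`P ∈ E(K[mℓ])`, `res g • P′ = (σ_ℓ^j P)′` (`′` = `dℓ.toGeomPoints`; tree `KolyvaginHeegnerData.toGeomPoints_pointGalHom`).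
In particular the correction term `(g − 1)P_{mℓ}` of McCallum's cocycle on `Γ_{K_λ}` is `((σ_ℓ^j − 1)P_{mℓ})′` — the
input of step (b2) (Gross Prop. 3.6: `(σ_ℓ − 1)P_{mℓ} = p^M Q_σ` with `Q_σ` explicit).
[cite: McCallumLMS1991, §4 proof of Prop. 4.4 (p. 302: «−(σ_l − 1)P_n/p^M»)] [cite: GrossLMS1991, Prop. 3.6] -/
theorem exists_absGaloisRestrict_smul_toGeomPoints_eq_pow (hK : IsImaginaryQuadratic K) (hm : m ≠ 0)
    {ℓ : ℕ} (hℓp : ℓ.Prime) (hℓP : (Ideal.span {(ℓ : 𝓞 K)}).IsPrime) (hℓm : ¬ ℓ ∣ m) (hsq : Squarefree (m * ℓ))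
    (dℓ : KolyvaginHeegnerData Dt β ι (m * ℓ))
    (w : HeightOneSpectrum (𝓞 K)) (hw : (ℓ : 𝓞 K) ∈ w.asIdeal)
    (hemb : ∀ (x : ringClassField K ι m) (x' : ringClassField K ι (m * ℓ)), (x : ℂ) = x' → dℓ.emb x' = d.emb x)
    (π' : absoluteGaloisGroup K → (ringClassField K ι (m * ℓ) ≃ₐ[ℚ] ringClassField K ι (m * ℓ)))
    (hπ' : ∀ (τ : absoluteGaloisGroup K) (x' : ringClassField K ι (m * ℓ)), τ • dℓ.emb x' = dℓ.emb (π' τ x'))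
    (g : absoluteGaloisGroup (w.adicCompletion K)) :
    ∃ j : ℕ, ∀ P : (W.baseChange (ringClassField K ι (m * ℓ))).toAffine.Point,
      absGaloisRestrict K (w.adicCompletion K) g • dℓ.toGeomPoints P =
        dℓ.toGeomPoints (pointGalHom W (ringClassField K ι (m * ℓ)) (dℓ.σ ℓ ^ j) P) := by
  obtain ⟨j, hj⟩ := exists_restrict_absGaloisRestrict_eq_pow d hK hm hℓp hℓP hℓm hsq dℓ w hw hemb π' hπ' g
  refine ⟨j, fun P ↦ ?_⟩
  rw [← hj]
  exact (dℓ.toGeomPoints_pointGalHom (fun x ↦ hπ' _ x) P).symm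

end Summit.BirchSwinnertonDyer.BirchSwinnertonDyer.Theorems.Prop44

end
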